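import Summits.QuantumFields.BalabanUV.T4Continuum.Support.NE7PairwiseFibreSplit

/-!
# NE7PairwiseFibreSplitLevels — row NE7 (node U5), route «PAIR-CAUCHY» (R-P2, 1-bis): the conditional fine-age
# suppression (5b) READ PER LEVEL — the CONDITIONAL twin of the per-level one-run bound (3), summable in the age,
# gives (5b) with `ρ_K = tail∕(1 − tail)` by a union bound inside each fibre

Cell `pub-balaban`, rung (B)+1 sub-cell t4, lineage `b2b-balaban-t4-ne7-p2` (CRUX PROVER NE7 #2 under the
coordinator ruling «YM redirect», 2026-08-21; generation 56; texts: `HOME/t4/b2b-balaban-t4-ne7-p2/g56/ROUTE2-NE7-P2.md`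
v1.11 §14 and the crux refuter's `HOME/b2b-balaban-t4-ne7-refuter/PRICING-NE7.md` v11.1 §63 (b) («(5) = (5a) ⊕ (5b)»:
the upper half of the good clause on full fibres needs a ONE-RUN CONDITIONAL fine-age suppression `Σ_{τ′↦τ, rough above
K} A′ ≤ ρ_K·Σ_{τ′↦τ, smooth above K} A′`, ρ_K null UV-uniformly — «§5 input (3) in CONDITIONAL form; in print the
(1.62)-class bounds in their native relative form»), and the headers of `Support/NE7PairwiseFibreSplit` (p264664: the
split (5) = (5a) ⊕ (5b) in kernel, `pairCauchy_of_levelPieces_split`), `Support/NE7PairwiseFibre` (p261562),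
`Support/NE7PairwiseDeepBadClass` (p259975: level tails).  HONEST FRAMING (page 1): FIXED FINITE T⁴, rung (B)+1 =
existence AND uniqueness of the `ε = L^{−K} → 0` limit of unit-scale averaged expectations, CONDITIONAL on BetaPertH and
the nine spine estimates (0/9 proved); NOT infinite volume, NOT a mass gap, NOT the Clay problem.  NE7 is NOT PRINTED in
[Balaban1984PropagatorsI]–[Balaban1989LargeFieldII] and NOT proved here.  Everything below is [folklore] finite-sum
bookkeeping over HYPOTHESIS SHAPES (abstract finite families of reals); no definition, no cite tag, nothing printed
asserted, no `sorry`.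

WHY.  `NE7PairwiseFibreSplit.pairCauchy_of_levelPieces_split` asks (5b) for the UNION of the finer run's level pieces
at the forgotten ages: per good coarse label `τ` at level `K`, `fiberSum (⋃_{j ∈ (K, K′]} LF K′ j t) ≤ ρ w K · fiberSum
(complement)`, `ρ w K → 0` uniformly in `K′`.  Its natural supplier shape is PER LEVEL, exactly as input (3) is: for
every run `K′`, every age `j` and every coarser level `K < j`, CONDITIONALLY on the level-`K` label `τ`, the relative
weight (inside the fibre over `τ`) of the run-`K′` labels carrying a large-field ∕ boundary piece at age `j` is `≤ q j` —
with ONE profile `q`, the same for every run and every coarser level (UV-uniformity), `0 ≤ q` summable, `Σ' q < 1`.  This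
is the CONDITIONAL TWIN of (3) (`Σ_{LF K′ j t} A K′ t ≤ p j·Σ_{T K′} A K′ t`): summed over the coarse labels it GIVES (3)
at that age (§3 `levelBound_of_condLevels`), and it is what a local, positive fine-scale action is expected to deliver
in print's relative form — a hypothesis SHAPE here, NOT instantiated.  From it, (5b) follows by a union bound INSIDE each
fibre: `fiberSum (⋃_{j ∈ (K,K′]} LF K′ j t) ≤ (Σ_{j ∈ (K,K′]} q j)·fiberSum (T K′) ≤ tail(K+1)·full`, `tail(m) := Σ'_j
q (j + m) < 1`, hence `≤ (tail∕(1 − tail))·smooth` (`NE7PairwiseFibreSplit.fiberSum_cond_of_relative`) with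
`ρ_K = tail(K+1)∕(1 − tail(K+1)) → 0` — a function of the COARSE level only (no window, no finer run).

WHAT IS PROVED ([folklore]).
§1 `fiberSum_biUnion_le` (union bound inside a fibre), `fiberSum_biUnion_le_mul` (per-piece relative bounds add up),
   `sum_Ioc_le_tail` (`Σ_{j ∈ (K, K′]} q j ≤ tail(K+1)`), `tail_lt_one`, `condRatio_nonneg`, **`tendsto_condRatio`**
   (`tail∕(1 − tail) → 0` along `K ↦ K + 1`).
§2 **`condSuppression_of_condLevels`** — (5b) ⟸ the per-level conditional relative bounds: for all `K, K′`, `|t| ≤ l₀`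
   and every coarse label `τ ∈ T K`, `fiberSum (⋃_{j ∈ (K,K′]} LF K′ j t) ≤ ρ_K · fiberSum (T K′ \ ⋃ …)` with
   `ρ_K = tail(K+1)∕(1 − tail(K+1))` (no window, no finer run in `ρ`).
§3 `levelBound_of_condLevels` — the conditional bounds summed over the coarse labels of level `j − 1` give the aggregate
   one-run bound (3) at every age `1 ≤ j ≤ K′` with `p = q` (so (3-cond) ⊇ (3) above age 0; age 0 stays with (3)).
§4 **`pairCauchy_of_levelPieces_condLevels`** — `pairCauchy_of_levelPieces_split` with (5b) DISCHARGED from the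
   per-level conditional bounds; inputs: one family of runs, projections, level pieces with (3) (`p`) inside the window's
   reach and (3-cond) (`q`) at the forgotten ages, compatibility, (5a) road P1's good clause on the smooth sub-fibres per
   window and offset sequence with a null remainder, `0 < vol`.
§5 EXITS BY NAME: **`genFunCauchy_of_levelPieces_condLevels`** (node U6), `hasContinuumLimit_of_levelPieces_condLevels`
   (node U0).
§6 (v1.1, generation 57; §§1–5's declarations byte-identical to v1 p265353; §3's header sentence now displays `j ≤ K′` —
   ERRATUM E-g56-1 = XREAD C-ne9leaf05g54-1 NIT-1) ONE ONE-RUN PROFILE: **`levelBound_of_condLevels_allAges`** ((3-cond) +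
   the AGE-0 aggregate bound + the depth convention `LF K j t = ∅` for `K < j` ⟹ the row (3) at EVERY age with `p := q`;
   the reader's remark (b2) of that X-read, re-proved), **`pairCauchy_of_levelPieces_oneProfile`** (§4 with its (3)-row
   REPLACED by the age-0 bound + depth convention — ONE profile `q` serves both rows), exit
   **`genFunCauchy_of_levelPieces_oneProfile`** (node U6; U0 as in §5): the socket's one-run input is ONE row, not two.

NOT DELIVERED: the per-level conditional bounds `q` and the aggregate bounds `p` for Bałaban's runs (rows NE7b ∕ NE7c's
printed TYPE (1.62), one run at a time, NOT instantiated), the level pieces ∕ projections ∕ compatibility (design), (5a)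
(road P1's END on the smooth sub-fibre = NODE O's small-field transport, (E♭-inst) (i), two-run supplier ask).  NOT NE7
(spine 0/9 unchanged), NOT summit progress.  HONEST DEPENDENCY: continuum YM on T⁴ ⇐ BetaPertH ∧ nine spine estimates
(0/9 proved); BetaPertH ⇐ (D1) ∧ (D4) ∧ CAP+tail; G-an2-4 gates asym, D1 and NE2/3/4.
-/

noncomputable section

open Finset Filter Topology
open scoped BigOperators

namespace Summit.QuantumFields.BalabanUV.T4Continuum.NE7PairwiseFibreSplitLevels

open Literature.MathematicalPhysics.QuantumFieldTheory
open Literature.MathematicalPhysics.QuantumFieldTheory.Balaban1983to89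
open T4HybridMatching (fiberSum sum_fiberSum fiberSum_nonneg)
open T4GoodClassBudget (GoodClause)
open Summit.QuantumFields.BalabanUV.T4Continuum.NE7PairwiseCauchyWindow (cauchySeq_genFun_of_pairCauchy)
open Summit.QuantumFields.BalabanUV.T4Continuum.NE7PairwiseOffsetEndWindow (sum_biUnion_le_sum_sum_of_nonneg)
open Summit.QuantumFields.BalabanUV.T4Continuum.NE7PairwiseDeepBadClass (sum_Icc_le_tsum_of_nonneg tendsto_tsum_tail)
open Summit.QuantumFields.BalabanUV.T4Continuum.NE7PairwiseFibre (tsum_tail_le_tsum)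
open Summit.QuantumFields.BalabanUV.T4Continuum.NE7PairwiseFibreSplit
  (fiberSum_split fiberSum_cond_of_relative biUnion_Ioc_subset pairCauchy_of_levelPieces_split)

/-! ## §1 Union bounds inside a fibre, level tails, and the conditional ratio -/

section Union

variable {σ ι κ : Type*} [DecidableEq ι] [DecidableEq σ]

/-- UNION BOUND INSIDE A FIBRE: the fibre sum over a finite union is at most the sum of the fibre sums over the pieces
(nonnegative weights). [folklore] -/
theorem fiberSum_biUnion_le (s : Finset κ) (f : κ → Finset σ) (π : σ → ι) {b : σ → ℝ} (hb : ∀ x, 0 ≤ b x)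
    (τ : ι) : fiberSum (s.biUnion f) π b τ ≤ ∑ j ∈ s, fiberSum (f j) π b τ := by
  unfold fiberSum
  rw [Finset.filter_biUnion]
  exact sum_biUnion_le_sum_sum_of_nonneg s _ hb

/-- PER-PIECE RELATIVE BOUNDS ADD UP: if each piece's fibre weight is `≤ q j ·` a reference fibre weight, the union's is
`≤ (Σ_j q j) ·` it. [folklore] -/
theorem fiberSum_biUnion_le_mul (s : Finset κ) (f : κ → Finset σ) {S : Finset σ} (π : σ → ι) {b : σ → ℝ}
    (hb : ∀ x, 0 ≤ b x) {q : κ → ℝ} (τ : ι) (h : ∀ j ∈ s, fiberSum (f j) π b τ ≤ q j * fiberSum S π b τ) :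
    fiberSum (s.biUnion f) π b τ ≤ (∑ j ∈ s, q j) * fiberSum S π b τ :=
  calc fiberSum (s.biUnion f) π b τ ≤ ∑ j ∈ s, fiberSum (f j) π b τ := fiberSum_biUnion_le s f π hb τ
    _ ≤ ∑ j ∈ s, q j * fiberSum S π b τ := Finset.sum_le_sum h
    _ = (∑ j ∈ s, q j) * fiberSum S π b τ := by rw [Finset.sum_mul]

end Union

section Tails

/-- The profile's mass at the forgotten ages `(K, K′]` is at most its tail from `K + 1` on. [folklore] -/
theorem sum_Ioc_le_tail {q : ℕ → ℝ} (hq0 : ∀ j, 0 ≤ q j) (hq : Summable q) (K K' : ℕ) :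
    ∑ j ∈ Finset.Ioc K K', q j ≤ ∑' j, q (j + (K + 1)) := by
  rw [← Finset.Icc_add_one_left_eq_Ioc]
  exact sum_Icc_le_tsum_of_nonneg hq0 hq (K + 1) K'

/-- Every tail of a nonnegative summable profile with `Σ' q < 1` is `< 1`. [folklore] -/
theorem tail_lt_one {q : ℕ → ℝ} (hq0 : ∀ j, 0 ≤ q j) (hq : Summable q) (hq1 : ∑' j, q j < 1) (m : ℕ) :
    ∑' j, q (j + m) < 1 :=
  lt_of_le_of_lt (tsum_tail_le_tsum hq0 hq m) hq1

/-- The conditional ratio `tail∕(1 − tail)` is nonnegative. [folklore] -/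
theorem condRatio_nonneg {q : ℕ → ℝ} (hq0 : ∀ j, 0 ≤ q j) (hq : Summable q) (hq1 : ∑' j, q j < 1) (m : ℕ) :
    0 ≤ (∑' j, q (j + m)) / (1 - ∑' j, q (j + m)) :=
  div_nonneg (tsum_nonneg fun j => hq0 (j + m)) (sub_nonneg.mpr (tail_lt_one hq0 hq hq1 m).le)

/-- **THE CONDITIONAL RATIO IS NULL**: `tail(K+1)∕(1 − tail(K+1)) → 0` as `K → ∞`. [folklore] -/
theorem tendsto_condRatio (q : ℕ → ℝ) :
    Tendsto (fun K => (∑' j, q (j + (K + 1))) / (1 - ∑' j, q (j + (K + 1)))) atTop (𝓝 0) := by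
  have ht : Tendsto (fun K => ∑' j, q (j + (K + 1))) atTop (𝓝 0) :=
    (tendsto_tsum_tail (p := q)).comp (tendsto_add_atTop_nat 1)
  have hd : Tendsto (fun K => 1 - ∑' j, q (j + (K + 1))) atTop (𝓝 1) := by
    simpa using tendsto_const_nhds.sub ht
  have h := ht.div hd one_ne_zero
  rw [zero_div] at h
  exact h

end Tails

/-! ## §2 (5b) from the per-level conditional relative bounds -/

section CondLevels

variable {ι : Type*} [DecidableEq ι] {l₀ : ℝ} {T : ℕ → Finset ι} {A : ℕ → ℝ → ι → ℝ}

/-- **(5b) ⟸ (3-cond).**  Level pieces `LF K′ j t ⊆ T K′`, globally nonnegative terms, and the PER-LEVEL CONDITIONAL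
relative bounds — for all `K < j ≤ K′`, `|t| ≤ l₀`, every coarse label `τ ∈ T K`: `fiberSum (LF K′ j t) (π K K′) (A K′ t)
τ ≤ q j · fiberSum (T K′) (π K K′) (A K′ t) τ` — with `0 ≤ q` summable, `Σ' q < 1` ⟹ the conditional suppression of
the forgotten-age union: `fiberSum (⋃_{j ∈ (K, K′]} LF K′ j t) ≤ ρ_K · fiberSum (T K′ \ ⋃ …)` with
`ρ_K = tail(K+1)∕(1 − tail(K+1))`, `tail(m) = Σ'_j q (j + m)` — uniform in `K′`, window-free. [folklore] -/
theorem condSuppression_of_condLevels (π : ℕ → ℕ → ι → ι) {LF : ℕ → ℕ → ℝ → Finset ι} {q : ℕ → ℝ}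
    (hA0 : ∀ K t, |t| ≤ l₀ → ∀ τ, 0 ≤ A K t τ) (hLF : ∀ K j t, |t| ≤ l₀ → LF K j t ⊆ T K)
    (hq0 : ∀ j, 0 ≤ q j) (hq : Summable q) (hq1 : ∑' j, q j < 1)
    (hcondj : ∀ K K' j t, K < j → j ≤ K' → |t| ≤ l₀ → ∀ τ ∈ T K,
      fiberSum (LF K' j t) (π K K') (A K' t) τ ≤ q j * fiberSum (T K') (π K K') (A K' t) τ)
    {K K' : ℕ} {t : ℝ} (ht : |t| ≤ l₀) {τ : ι} (hτ : τ ∈ T K) :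
    fiberSum ((Finset.Ioc K K').biUnion (fun j => LF K' j t)) (π K K') (A K' t) τ
      ≤ (∑' j, q (j + (K + 1))) / (1 - ∑' j, q (j + (K + 1))) *
        fiberSum (T K' \ (Finset.Ioc K K').biUnion (fun j => LF K' j t)) (π K K') (A K' t) τ := by
  refine fiberSum_cond_of_relative (biUnion_Ioc_subset fun j => hLF K' j t ht) (tail_lt_one hq0 hq hq1 (K + 1)) ?_
  refine (fiberSum_biUnion_le_mul (Finset.Ioc K K') (fun j => LF K' j t) (S := T K') (π K K') (hA0 K' t ht) (q := q) τ
    fun j hj => ?_).trans ?_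
  · obtain ⟨hKj, hjK'⟩ := Finset.mem_Ioc.mp hj
    exact hcondj K K' j t hKj hjK' ht τ hτ
  · exact mul_le_mul_of_nonneg_right (sum_Ioc_le_tail hq0 hq K K')
      (fiberSum_nonneg (fun s _ => hA0 K' t ht s) τ)

end CondLevels

/-! ## §3 The conditional bounds contain the aggregate ones above age 0 -/

section Aggregate

variable {ι : Type*} [DecidableEq ι] {l₀ : ℝ} {T : ℕ → Finset ι} {A : ℕ → ℝ → ι → ℝ}

/-- **(3-cond) ⊇ (3) ABOVE AGE 0.**  Summing the conditional relative bound at age `j ≥ 1` over the coarse labels of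
level `j − 1` (the projection maps the finer labels INTO them) gives the aggregate one-run bound of the level piece:
`Σ_{LF K′ j t} A K′ t ≤ q j · Σ_{T K′} A K′ t`. [folklore] -/
theorem levelBound_of_condLevels (π : ℕ → ℕ → ι → ι) {LF : ℕ → ℕ → ℝ → Finset ι} {q : ℕ → ℝ}
    (hmaps : ∀ K K', K ≤ K' → ∀ τ' ∈ T K', π K K' τ' ∈ T K) (hLF : ∀ K j t, |t| ≤ l₀ → LF K j t ⊆ T K)
    (hcondj : ∀ K K' j t, K < j → j ≤ K' → |t| ≤ l₀ → ∀ τ ∈ T K,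
      fiberSum (LF K' j t) (π K K') (A K' t) τ ≤ q j * fiberSum (T K') (π K K') (A K' t) τ)
    {K' j : ℕ} (hj : 1 ≤ j) (hjK' : j ≤ K') {t : ℝ} (ht : |t| ≤ l₀) :
    ∑ τ' ∈ LF K' j t, A K' t τ' ≤ q j * ∑ τ' ∈ T K', A K' t τ' := by
  have hK : j - 1 < j := Nat.sub_lt hj one_pos
  have hKK' : j - 1 ≤ K' := (Nat.sub_le j 1).trans hjK'
  have hm := hmaps (j - 1) K' hKK'
  rw [← sum_fiberSum (A K' t) hm, ← sum_fiberSum (S := LF K' j t) (A K' t) (fun s hs => hm s (hLF K' j t ht hs)),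
    Finset.mul_sum]
  exact Finset.sum_le_sum fun τ hτ => hcondj (j - 1) K' j t hK hjK' ht τ hτ

end Aggregate

/-! ## §4 The socket with (5b) discharged from the per-level conditional bounds -/

section Socket

variable {ι : Type*} [DecidableEq ι] {l₀ vol : ℝ} {T : ℕ → Finset ι} {A : ℕ → ℝ → ι → ℝ} {Z : ℕ → ℝ → ℝ}

/-- **PAIR-CAUCHY FROM PER-LEVEL ONE-RUN DATA IN BOTH FORMS + (5a).**  One family of runs (labels `T K`, terms `A ≥ 0`
globally, `Z = Σ A > 0`, `0 < vol`); projections `π K K′` with maps-to; level pieces `LF K j t ⊆ T K`, compatible under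
projection; (3) aggregate one-run bounds `p j` (`0 ≤ p` summable, `Σ' p < 1`); (3-cond) per-level CONDITIONAL relative
bounds `q j` at the forgotten ages (`0 ≤ q` summable, `Σ' q < 1`; per coarse label, uniform in the finer run); and (5a)
road P1's good clause, per window and offset sequence, for `(A K, fibre sum of A (K + ν K) over the labels with no
large-field piece at the ages (K, K + ν K])`, null remainder.  THEN all pairs `K₀ ≤ K ≤ K′` match within any `ε > 0`.
[folklore] -/
theorem pairCauchy_of_levelPieces_condLevels (π : ℕ → ℕ → ι → ι) {LF : ℕ → ℕ → ℝ → Finset ι} {p q : ℕ → ℝ}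
    {δ : ℕ → (ℕ → ℕ) → ℕ → ℝ} (hvol : 0 < vol)
    (hZA : ∀ (K : ℕ) (t : ℝ), |t| ≤ l₀ → Z K t = ∑ τ ∈ T K, A K t τ)
    (hpos : ∀ (K : ℕ) (t : ℝ), |t| ≤ l₀ → 0 < ∑ τ ∈ T K, A K t τ)
    (hA0 : ∀ K t, |t| ≤ l₀ → ∀ τ, 0 ≤ A K t τ)
    (hmaps : ∀ K K', K ≤ K' → ∀ τ' ∈ T K', π K K' τ' ∈ T K)
    (hLF : ∀ K j t, |t| ≤ l₀ → LF K j t ⊆ T K)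
    (hcompat : ∀ K K' t, K ≤ K' → |t| ≤ l₀ → ∀ j, j ≤ K → ∀ τ', π K K' τ' ∈ LF K j t → τ' ∈ LF K' j t)
    (hp0 : ∀ j, 0 ≤ p j) (hp : Summable p) (hp1 : ∑' j, p j < 1)
    (hpLF : ∀ K j t, |t| ≤ l₀ → ∑ τ ∈ LF K j t, A K t τ ≤ p j * ∑ τ ∈ T K, A K t τ)
    (hq0 : ∀ j, 0 ≤ q j) (hq : Summable q) (hq1 : ∑' j, q j < 1)
    (hcondj : ∀ K K' j t, K < j → j ≤ K' → |t| ≤ l₀ → ∀ τ ∈ T K,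
      fiberSum (LF K' j t) (π K K') (A K' t) τ ≤ q j * fiberSum (T K') (π K K') (A K' t) τ)
    (hgoodS : ∀ w (ν : ℕ → ℕ), GoodClause l₀ vol T A
      (fun K t => fiberSum (T (K + ν K) \ (Finset.Ioc K (K + ν K)).biUnion (fun j => LF (K + ν K) j t))
        (π K (K + ν K)) (A (K + ν K) t))
      (fun K t => (Finset.Icc w K).biUnion (fun j => LF K j t)) (δ w ν))
    (hδ : ∀ w ν, Tendsto (δ w ν) atTop (𝓝 0)) :
    ∀ ε : ℝ, 0 < ε → ∃ K₀ : ℕ, ∀ K K' : ℕ, K₀ ≤ K → K ≤ K' →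
      ∃ c : ℝ, ∀ t : ℝ, |t| ≤ l₀ → |Real.log (Z K' t) - Real.log (Z K t) - c| ≤ ε :=
  pairCauchy_of_levelPieces_split π
    (ρ := fun _ K => (∑' j, q (j + (K + 1))) / (1 - ∑' j, q (j + (K + 1))))
    hvol hZA hpos hA0 hmaps hLF hcompat hp0 hp hp1 hpLF hgoodS hδ
    (fun _ _ _ _ _ ht _ hτ => condSuppression_of_condLevels π hA0 hLF hq0 hq hq1 hcondj ht (Finset.mem_sdiff.mp hτ).1)
    (fun _ K => condRatio_nonneg hq0 hq hq1 (K + 1)) (fun _ => tendsto_condRatio q)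

end Socket

/-! ## §5 Exits by name: node U6 and node U0 -/

section Exit

open Missing T4Continuum T4Assembly

variable {G : Type*} [GaugeGroup G] [MeasurableSpace G] [HaarData G] {O : Type*}

/-- **NODE U6 FROM PER-LEVEL ONE-RUN DATA IN BOTH FORMS + (5a).**  Per string `os`: one family of runs on labels `T K`
(`0 < vol`, terms `≥ 0`, `Z > 0`), projections, level pieces with the aggregate bounds `p` (3) and the per-level
conditional bounds `q` at the forgotten ages (3-cond), compatibility, and (5a) road P1's good clause on the smooth
sub-fibres per window and offset sequence with a null remainder ⟹ `GenFunCauchy S l₀`. [folklore] -/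
theorem genFunCauchy_of_levelPieces_condLevels {ι : Type*} [DecidableEq ι] (S : TorusScheme G O) {l₀ : ℝ}
    (hl₀ : 0 ≤ l₀)
    (h : ∀ os : List O, ∃ (vol : ℝ) (T : ℕ → Finset ι) (A : ℕ → ℝ → ι → ℝ) (π : ℕ → ℕ → ι → ι)
      (LF : ℕ → ℕ → ℝ → Finset ι) (p q : ℕ → ℝ) (δ : ℕ → (ℕ → ℕ) → ℕ → ℝ),
      0 < vol ∧
      (∀ (K : ℕ) (t : ℝ), |t| ≤ l₀ → T4GenFunBounds.schemeZ S os K t = ∑ τ ∈ T K, A K t τ) ∧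
      (∀ (K : ℕ) (t : ℝ), |t| ≤ l₀ → 0 < ∑ τ ∈ T K, A K t τ) ∧
      (∀ K t, |t| ≤ l₀ → ∀ τ, 0 ≤ A K t τ) ∧
      (∀ K K', K ≤ K' → ∀ τ' ∈ T K', π K K' τ' ∈ T K) ∧
      (∀ K j t, |t| ≤ l₀ → LF K j t ⊆ T K) ∧
      (∀ K K' t, K ≤ K' → |t| ≤ l₀ → ∀ j, j ≤ K → ∀ τ', π K K' τ' ∈ LF K j t → τ' ∈ LF K' j t) ∧
      (∀ j, 0 ≤ p j) ∧ Summable p ∧ ∑' j, p j < 1 ∧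
      (∀ K j t, |t| ≤ l₀ → ∑ τ ∈ LF K j t, A K t τ ≤ p j * ∑ τ ∈ T K, A K t τ) ∧
      (∀ j, 0 ≤ q j) ∧ Summable q ∧ ∑' j, q j < 1 ∧
      (∀ K K' j t, K < j → j ≤ K' → |t| ≤ l₀ → ∀ τ ∈ T K,
        fiberSum (LF K' j t) (π K K') (A K' t) τ ≤ q j * fiberSum (T K') (π K K') (A K' t) τ) ∧
      (∀ w (ν : ℕ → ℕ), GoodClause l₀ vol T A
        (fun K t => fiberSum (T (K + ν K) \ (Finset.Ioc K (K + ν K)).biUnion (fun j => LF (K + ν K) j t))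
          (π K (K + ν K)) (A (K + ν K) t))
        (fun K t => (Finset.Icc w K).biUnion (fun j => LF K j t)) (δ w ν)) ∧
      (∀ w ν, Tendsto (δ w ν) atTop (𝓝 0))) :
    GenFunCauchy S l₀ := by
  intro os t ht
  obtain ⟨vol, T, A, π, LF, p, q, δ, hvol, hZA, hpos, hA0, hmaps, hLF, hcompat, hp0, hp, hp1, hpLF, hq0, hq, hq1,
    hcondj, hgoodS, hδ⟩ := h os
  exact cauchySeq_genFun_of_pairCauchy hl₀
    (pairCauchy_of_levelPieces_condLevels π hvol hZA hpos hA0 hmaps hLF hcompat hp0 hp hp1 hpLF hq0 hq hq1 hcondj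
      hgoodS hδ) ht

/-- … and NODE U0 (`Missing.HasContinuumLimit S`) by `T4Assembly.hasContinuumLimit_of_genFunCauchy`. [folklore] -/
theorem hasContinuumLimit_of_levelPieces_condLevels [RegularGaugeGroup G] {ι : Type*} [DecidableEq ι]
    (S : TorusScheme G O) (hβ : ∀ K, 0 ≤ S.β K) (hm : ∀ K o, Measurable (S.obs K o))
    (h1 : ∀ K o U, |S.obs K o U| ≤ 1) {l₀ : ℝ} (hl₀ : 0 < l₀)
    (h : ∀ os : List O, ∃ (vol : ℝ) (T : ℕ → Finset ι) (A : ℕ → ℝ → ι → ℝ) (π : ℕ → ℕ → ι → ι)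
      (LF : ℕ → ℕ → ℝ → Finset ι) (p q : ℕ → ℝ) (δ : ℕ → (ℕ → ℕ) → ℕ → ℝ),
      0 < vol ∧
      (∀ (K : ℕ) (t : ℝ), |t| ≤ l₀ → T4GenFunBounds.schemeZ S os K t = ∑ τ ∈ T K, A K t τ) ∧
      (∀ (K : ℕ) (t : ℝ), |t| ≤ l₀ → 0 < ∑ τ ∈ T K, A K t τ) ∧
      (∀ K t, |t| ≤ l₀ → ∀ τ, 0 ≤ A K t τ) ∧
      (∀ K K', K ≤ K' → ∀ τ' ∈ T K', π K K' τ' ∈ T K) ∧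
      (∀ K j t, |t| ≤ l₀ → LF K j t ⊆ T K) ∧
      (∀ K K' t, K ≤ K' → |t| ≤ l₀ → ∀ j, j ≤ K → ∀ τ', π K K' τ' ∈ LF K j t → τ' ∈ LF K' j t) ∧
      (∀ j, 0 ≤ p j) ∧ Summable p ∧ ∑' j, p j < 1 ∧
      (∀ K j t, |t| ≤ l₀ → ∑ τ ∈ LF K j t, A K t τ ≤ p j * ∑ τ ∈ T K, A K t τ) ∧
      (∀ j, 0 ≤ q j) ∧ Summable q ∧ ∑' j, q j < 1 ∧
      (∀ K K' j t, K < j → j ≤ K' → |t| ≤ l₀ → ∀ τ ∈ T K,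
        fiberSum (LF K' j t) (π K K') (A K' t) τ ≤ q j * fiberSum (T K') (π K K') (A K' t) τ) ∧
      (∀ w (ν : ℕ → ℕ), GoodClause l₀ vol T A
        (fun K t => fiberSum (T (K + ν K) \ (Finset.Ioc K (K + ν K)).biUnion (fun j => LF (K + ν K) j t))
          (π K (K + ν K)) (A (K + ν K) t))
        (fun K t => (Finset.Icc w K).biUnion (fun j => LF K j t)) (δ w ν)) ∧
      (∀ w ν, Tendsto (δ w ν) atTop (𝓝 0))) :
    Missing.HasContinuumLimit S :=
  hasContinuumLimit_of_genFunCauchy S hβ hm h1 hl₀ (genFunCauchy_of_levelPieces_condLevels S hl₀.le h)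

end Exit

/-! ## §6 (v1.1) ONE one-run profile: (3-cond) + the age-0 aggregate bound give (3) at every age -/

section OneProfile

variable {ι : Type*} [DecidableEq ι] {l₀ vol : ℝ} {T : ℕ → Finset ι} {A : ℕ → ℝ → ι → ℝ} {Z : ℕ → ℝ → ℝ}

/-- **(3) AT EVERY AGE FROM (3-cond) + THE AGE-0 PIECE**: `q`'s conditional bounds (§3: ages `1 ≤ j ≤ K′`), an age-0
aggregate bound with `q 0` and the depth convention `LF K j t = ∅` (`K < j`) give the row (3) with `p := q`. [folklore] -/
theorem levelBound_of_condLevels_allAges (π : ℕ → ℕ → ι → ι) {LF : ℕ → ℕ → ℝ → Finset ι} {q : ℕ → ℝ}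
    (hA0 : ∀ K t, |t| ≤ l₀ → ∀ τ, 0 ≤ A K t τ)
    (hmaps : ∀ K K', K ≤ K' → ∀ τ' ∈ T K', π K K' τ' ∈ T K) (hLF : ∀ K j t, |t| ≤ l₀ → LF K j t ⊆ T K)
    (hq0 : ∀ j, 0 ≤ q j)
    (hcondj : ∀ K K' j t, K < j → j ≤ K' → |t| ≤ l₀ → ∀ τ ∈ T K,
      fiberSum (LF K' j t) (π K K') (A K' t) τ ≤ q j * fiberSum (T K') (π K K') (A K' t) τ)
    (h0 : ∀ K t, |t| ≤ l₀ → ∑ τ ∈ LF K 0 t, A K t τ ≤ q 0 * ∑ τ ∈ T K, A K t τ)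
    (hdepth : ∀ K j t, K < j → LF K j t = ∅) :
    ∀ K j t, |t| ≤ l₀ → ∑ τ ∈ LF K j t, A K t τ ≤ q j * ∑ τ ∈ T K, A K t τ := by
  intro K j t ht
  rcases Nat.eq_zero_or_pos j with hj | hj
  · subst hj
    exact h0 K t ht
  · rcases le_or_gt j K with hjK | hKj
    · exact levelBound_of_condLevels π hmaps hLF hcondj hj hjK ht
    · rw [hdepth K j t hKj, Finset.sum_empty]
      exact mul_nonneg (hq0 j) (Finset.sum_nonneg fun τ _ => hA0 K t ht τ)

/-- **THE SOCKET WITH ONE ONE-RUN PROFILE**: §4 `pairCauchy_of_levelPieces_condLevels` with its aggregate row (3)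
(`p`, `hp0 hp hp1 hpLF`) REPLACED by the AGE-0 bound `h0` and the depth convention `hdepth` — the single profile `q`
(`0 ≤ q` summable, `Σ' q < 1`) serves the bad-class mass (level tails) AND the conditional suppression (5b); (5a) and
the design data as in §4. [folklore] -/
theorem pairCauchy_of_levelPieces_oneProfile (π : ℕ → ℕ → ι → ι) {LF : ℕ → ℕ → ℝ → Finset ι} {q : ℕ → ℝ}
    {δ : ℕ → (ℕ → ℕ) → ℕ → ℝ} (hvol : 0 < vol)
    (hZA : ∀ (K : ℕ) (t : ℝ), |t| ≤ l₀ → Z K t = ∑ τ ∈ T K, A K t τ)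
    (hpos : ∀ (K : ℕ) (t : ℝ), |t| ≤ l₀ → 0 < ∑ τ ∈ T K, A K t τ)
    (hA0 : ∀ K t, |t| ≤ l₀ → ∀ τ, 0 ≤ A K t τ)
    (hmaps : ∀ K K', K ≤ K' → ∀ τ' ∈ T K', π K K' τ' ∈ T K)
    (hLF : ∀ K j t, |t| ≤ l₀ → LF K j t ⊆ T K)
    (hcompat : ∀ K K' t, K ≤ K' → |t| ≤ l₀ → ∀ j, j ≤ K → ∀ τ', π K K' τ' ∈ LF K j t → τ' ∈ LF K' j t)
    (hq0 : ∀ j, 0 ≤ q j) (hq : Summable q) (hq1 : ∑' j, q j < 1)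
    (hcondj : ∀ K K' j t, K < j → j ≤ K' → |t| ≤ l₀ → ∀ τ ∈ T K,
      fiberSum (LF K' j t) (π K K') (A K' t) τ ≤ q j * fiberSum (T K') (π K K') (A K' t) τ)
    (h0 : ∀ K t, |t| ≤ l₀ → ∑ τ ∈ LF K 0 t, A K t τ ≤ q 0 * ∑ τ ∈ T K, A K t τ)
    (hdepth : ∀ K j t, K < j → LF K j t = ∅)
    (hgoodS : ∀ w (ν : ℕ → ℕ), GoodClause l₀ vol T A
      (fun K t => fiberSum (T (K + ν K) \ (Finset.Ioc K (K + ν K)).biUnion (fun j => LF (K + ν K) j t))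
        (π K (K + ν K)) (A (K + ν K) t))
      (fun K t => (Finset.Icc w K).biUnion (fun j => LF K j t)) (δ w ν))
    (hδ : ∀ w ν, Tendsto (δ w ν) atTop (𝓝 0)) :
    ∀ ε : ℝ, 0 < ε → ∃ K₀ : ℕ, ∀ K K' : ℕ, K₀ ≤ K → K ≤ K' →
      ∃ c : ℝ, ∀ t : ℝ, |t| ≤ l₀ → |Real.log (Z K' t) - Real.log (Z K t) - c| ≤ ε :=
  pairCauchy_of_levelPieces_condLevels π hvol hZA hpos hA0 hmaps hLF hcompat hq0 hq hq1
    (levelBound_of_condLevels_allAges π hA0 hmaps hLF hq0 hcondj h0 hdepth) hq0 hq hq1 hcondj hgoodS hδ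

end OneProfile
section ExitOneProfile

open Missing T4Continuum T4Assembly

variable {G : Type*} [GaugeGroup G] [MeasurableSpace G] [HaarData G] {O : Type*}

/-- **NODE U6 WITH ONE ONE-RUN PROFILE** (v1.1): per string, one family of runs, projections, compatible level pieces
with the depth convention, ONE profile `q` carrying (3-cond) and the age-0 aggregate bound, and (5a) per window and
offset sequence with a null remainder ⟹ `GenFunCauchy S l₀` (node U0 by `hasContinuumLimit_of_genFunCauchy`). [folklore] -/
theorem genFunCauchy_of_levelPieces_oneProfile {ι : Type*} [DecidableEq ι] (S : TorusScheme G O) {l₀ : ℝ}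
    (hl₀ : 0 ≤ l₀)
    (h : ∀ os : List O, ∃ (vol : ℝ) (T : ℕ → Finset ι) (A : ℕ → ℝ → ι → ℝ) (π : ℕ → ℕ → ι → ι)
      (LF : ℕ → ℕ → ℝ → Finset ι) (q : ℕ → ℝ) (δ : ℕ → (ℕ → ℕ) → ℕ → ℝ),
      0 < vol ∧
      (∀ (K : ℕ) (t : ℝ), |t| ≤ l₀ → T4GenFunBounds.schemeZ S os K t = ∑ τ ∈ T K, A K t τ) ∧
      (∀ (K : ℕ) (t : ℝ), |t| ≤ l₀ → 0 < ∑ τ ∈ T K, A K t τ) ∧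
      (∀ K t, |t| ≤ l₀ → ∀ τ, 0 ≤ A K t τ) ∧
      (∀ K K', K ≤ K' → ∀ τ' ∈ T K', π K K' τ' ∈ T K) ∧
      (∀ K j t, |t| ≤ l₀ → LF K j t ⊆ T K) ∧
      (∀ K K' t, K ≤ K' → |t| ≤ l₀ → ∀ j, j ≤ K → ∀ τ', π K K' τ' ∈ LF K j t → τ' ∈ LF K' j t) ∧
      (∀ j, 0 ≤ q j) ∧ Summable q ∧ ∑' j, q j < 1 ∧
      (∀ K K' j t, K < j → j ≤ K' → |t| ≤ l₀ → ∀ τ ∈ T K,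
        fiberSum (LF K' j t) (π K K') (A K' t) τ ≤ q j * fiberSum (T K') (π K K') (A K' t) τ) ∧
      (∀ K t, |t| ≤ l₀ → ∑ τ ∈ LF K 0 t, A K t τ ≤ q 0 * ∑ τ ∈ T K, A K t τ) ∧
      (∀ K j t, K < j → LF K j t = ∅) ∧
      (∀ w (ν : ℕ → ℕ), GoodClause l₀ vol T A
        (fun K t => fiberSum (T (K + ν K) \ (Finset.Ioc K (K + ν K)).biUnion (fun j => LF (K + ν K) j t))
          (π K (K + ν K)) (A (K + ν K) t))
        (fun K t => (Finset.Icc w K).biUnion (fun j => LF K j t)) (δ w ν)) ∧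
      (∀ w ν, Tendsto (δ w ν) atTop (𝓝 0))) :
    GenFunCauchy S l₀ := by
  intro os t ht
  obtain ⟨vol, T, A, π, LF, q, δ, hvol, hZA, hpos, hA0, hmaps, hLF, hcompat, hq0, hq, hq1, hcondj, h0, hdepth, hgoodS,
    hδ⟩ := h os
  exact cauchySeq_genFun_of_pairCauchy hl₀
    (pairCauchy_of_levelPieces_oneProfile π hvol hZA hpos hA0 hmaps hLF hcompat hq0 hq hq1 hcondj h0 hdepth hgoodS hδ)
    ht

end ExitOneProfile

end Summit.QuantumFields.BalabanUV.T4Continuum.NE7PairwiseFibreSplitLevels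

end
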